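import Mathlib
import HarnessLib
import Summits.Ventures.LatticeQCDFlow.Scoring.ChainBlockMarkov
import Summits.Ventures.LatticeQCDFlow.Scoring.ChainSkeletonAverages
import Summits.Ventures.LatticeQCDFlow.Scoring.GeometricEnvelopeBlockSumMoments

/-!
# The law of large numbers for LAG PRODUCTS from any start:
# `E_{μ₀} |(1/N) Σ_{i<N} g(X_i) h(X_{i+k}) − ∫ g·(kop κ)^k h dπ| ≤ 2C_gC_h (√(2k+1) + 2√10·A/(1−ρ))/√N`

HONEST FRAMING: exact (Metropolis-corrected) sampling algorithms for lattice gauge theory;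
figures of merit are autocorrelation/cost numbers at stated couplings and volumes; no
continuum-physics claim.

Venture `LatticeQCDFlow` (cell pub-lqcd), topic `Scoring`; FANOUT row 4 (`s0-u1-b`, GEN-31).
NEW WORK of the cell, not a published result; no definition is introduced; nothing is cited as a
fact.  Setting: a Markov kernel `κ` with invariant probability `π` and a geometric sup-norm envelope
`|(kop κ)^t g − πg| ≤ 2‖g‖∞ A ρ^t` (`0 ≤ ρ < 1`), bounded measurable `g, h`, a lag `k`, and the chain
`X` started from an ARBITRARY law `μ₀`.  The empirical lag-`k` product `(1/N) Σ_{i<N} g(X_i) h(X_{i+k})`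
estimates `E_π[g(X_0) h(X_k)] = ∫ g·(kop κ)^k h dπ` (for `g = h = f̄` the autocovariance `γ_k`);
this file proves the `L¹` rate displayed in the title, uniformly in the start.  Route: write
`g(X_i) h(X_{i+k}) = d_i + φ(X_i)` with `φ = g·(kop κ)^k h` the conditional mean given `X_i`
(`Scoring/ChainSkeletonAverages.chain_dirac_integral_mul_eval_eq`) and `d_i` the conditionally
centred product; by the Markov property with a past weight (`Scoring/ChainBlockMarkov.lean`) the
`d_i` are ORTHOGONAL at distance `≥ k`, so `E(Σ_{i<N} d_i)² ≤ (2k+1) N (2C_gC_h)²`, while the time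
average of `φ` is within `√10·4C_gC_hA/((1−ρ)√N)` of `πφ` in `L¹`
(`Scoring/GeometricEnvelopeBlockSumMoments.chain_blockSum_sq_le_of_envelope`).  This is the first
step towards estimating the leading bias constant `Γ_f = Σ_{k≥1} k γ_k` of the batch-means estimator
(`Scoring/BatchMeansBiasIdentification.lean`) from the run itself.

## Content

* `sum_sum_band_le` — a double sum over `{0,…,N−1}²` of a kernel vanishing off the band `|i−j| ≤ k`
  and bounded by `B` on it is `≤ (2k+1) N B` in absolute value;
* `abs_lagProduct_centred_le`, **`chain_lagProduct_centred_orthogonal`** (`i + k ≤ j ⇒ E[d_i d_j] = 0`),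
  `chain_lagProduct_centred_sum_sq_integral_le` (`E(Σ_{i<N} d_i)² ≤ (2k+1) N (2C_gC_h)²`);
* `integral_abs_le_sqrt_integral_sq` (`E|S| ≤ √(E S²)` for bounded measurable `S`);
* **`chain_lagProductAverage_abs_sub_le_of_envelope`** — the theorem in the title;
* **`chain_sampleAutocov_abs_sub_le_of_envelope`** — `g = h = f − πf`:
  `E_{μ₀} |(1/N) Σ_{i<N} f̄(X_i) f̄(X_{i+k}) − autocov κ π f̄ k| ≤ 8C² (√(2k+1) + 2√10·A/(1−ρ))/√N`.

NOT CLAIMED: the centring by the SAMPLE mean (next file); optimal constants; unbounded observables.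
-/

noncomputable section

namespace Summit.Ventures.LatticeQCDFlow.Scoring

open MeasureTheory ProbabilityTheory Filter Finset
open scoped ENNReal Topology

variable {Ω : Type*} [MeasurableSpace Ω]

/-! ### Counting the pairs at distance `≤ k` -/

/-- A double sum over `{0,…,N−1}²` of a kernel bounded by `B` and vanishing off the band
`j ≤ i + k ∧ i ≤ j + k` is at most `(2k+1) N B` in absolute value. -/
theorem sum_sum_band_le {c : ℕ → ℕ → ℝ} {B : ℝ} (hB : 0 ≤ B) {k N : ℕ}
    (hc : ∀ i j, |c i j| ≤ B) (hz : ∀ i j, i + k < j ∨ j + k < i → c i j = 0) :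
    |∑ i ∈ Finset.range N, ∑ j ∈ Finset.range N, c i j| ≤ (2 * k + 1) * N * B := by
  have hrow : ∀ i, |∑ j ∈ Finset.range N, c i j| ≤ (2 * k + 1) * B := by
    intro i
    have hsplit : ∑ j ∈ Finset.range N, c i j
        = ∑ j ∈ (Finset.range N).filter (fun j => j ≤ i + k ∧ i ≤ j + k), c i j := by
      rw [Finset.sum_filter]
      refine Finset.sum_congr rfl fun j _ => ?_
      by_cases hj : j ≤ i + k ∧ i ≤ j + k
      · rw [if_pos hj]
      · rw [if_neg hj]; exact hz i j (by omega)
    have hsub : (Finset.range N).filter (fun j => j ≤ i + k ∧ i ≤ j + k) ⊆ Finset.Icc (i - k) (i + k) := by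
      intro j hj
      rw [Finset.mem_filter] at hj
      rw [Finset.mem_Icc]; omega
    have hcard := Finset.card_le_card hsub
    rw [Nat.card_Icc] at hcard
    have hcard' : (((Finset.range N).filter (fun j => j ≤ i + k ∧ i ≤ j + k)).card : ℝ) ≤ 2 * k + 1 := by
      have : ((Finset.range N).filter (fun j => j ≤ i + k ∧ i ≤ j + k)).card ≤ 2 * k + 1 := by omega
      exact_mod_cast this
    rw [hsplit]
    calc |∑ j ∈ (Finset.range N).filter (fun j => j ≤ i + k ∧ i ≤ j + k), c i j|
        ≤ ∑ j ∈ (Finset.range N).filter (fun j => j ≤ i + k ∧ i ≤ j + k), |c i j| :=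
          Finset.abs_sum_le_sum_abs _ _
      _ ≤ ∑ j ∈ (Finset.range N).filter (fun j => j ≤ i + k ∧ i ≤ j + k), B :=
          Finset.sum_le_sum fun j _ => hc i j
      _ = ((Finset.range N).filter (fun j => j ≤ i + k ∧ i ≤ j + k)).card * B := by
          rw [Finset.sum_const, nsmul_eq_mul]
      _ ≤ (2 * k + 1) * B := mul_le_mul_of_nonneg_right hcard' hB
  calc |∑ i ∈ Finset.range N, ∑ j ∈ Finset.range N, c i j|
      ≤ ∑ i ∈ Finset.range N, |∑ j ∈ Finset.range N, c i j| := Finset.abs_sum_le_sum_abs _ _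
    _ ≤ ∑ i ∈ Finset.range N, (2 * k + 1) * B := Finset.sum_le_sum fun i _ => hrow i
    _ = (2 * k + 1) * N * B := by rw [Finset.sum_const, Finset.card_range, nsmul_eq_mul]; ring

/-- `E|S| ≤ √(E S²)` for a bounded measurable `S` under a probability law. -/
theorem integral_abs_le_sqrt_integral_sq (μ : Measure Ω) [IsProbabilityMeasure μ] {S : Ω → ℝ}
    (hS : Measurable S) {C : ℝ} (hC : ∀ x, |S x| ≤ C) :
    ∫ x, |S x| ∂μ ≤ Real.sqrt (∫ x, S x ^ 2 ∂μ) := by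
  have h1 := sq_integral_le_integral_sq μ (continuous_abs.measurable.comp hS) (C := C)
    (fun x => by rw [Function.comp_apply, abs_abs]; exact hC x)
  simp only [Function.comp_apply, sq_abs] at h1
  rw [← Real.sqrt_sq (integral_nonneg fun x => abs_nonneg (S x))]
  exact Real.sqrt_le_sqrt h1

section Chain

variable {κ : Kernel Ω Ω} [IsMarkovKernel κ]

/-- The conditionally centred lag product is bounded:
`|g(x_i) h(x_{i+k}) − g(x_i)(kop κ)^k h (x_i)| ≤ 2 C_g C_h`. -/
theorem abs_lagProduct_centred_le {g h : Ω → ℝ} {Cg Ch : ℝ} (hCg : ∀ x, |g x| ≤ Cg)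
    (hh : Measurable h) (hCh : ∀ x, |h x| ≤ Ch) (i k : ℕ) (x : ℕ → Ω) :
    |g (x i) * h (x (i + k)) - g (x i) * (kop κ)^[k] h (x i)| ≤ 2 * (Cg * Ch) := by
  have hCg0 : 0 ≤ Cg := (abs_nonneg _).trans (hCg (x i))
  obtain ⟨-, hkb⟩ := iterate_kop_bounded_measurable κ hh hCh k
  calc |g (x i) * h (x (i + k)) - g (x i) * (kop κ)^[k] h (x i)|
      ≤ |g (x i) * h (x (i + k))| + |g (x i) * (kop κ)^[k] h (x i)| := abs_sub _ _
    _ ≤ Cg * Ch + Cg * Ch := by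
        rw [abs_mul, abs_mul]
        exact add_le_add (mul_le_mul (hCg _) (hCh _) (abs_nonneg _) hCg0)
          (mul_le_mul (hCg _) (hkb _) (abs_nonneg _) hCg0)
    _ = 2 * (Cg * Ch) := by ring

/-- The conditionally centred lag product is measurable on path space. -/
theorem measurable_lagProduct_centred {g h : Ω → ℝ} (hg : Measurable g) (hh : Measurable h)
    {Ch : ℝ} (hCh : ∀ x, |h x| ≤ Ch) (i k : ℕ) :
    Measurable fun x : ℕ → Ω => g (x i) * h (x (i + k)) - g (x i) * (kop κ)^[k] h (x i) := by
  obtain ⟨hkm, -⟩ := iterate_kop_bounded_measurable κ hh hCh k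
  exact ((hg.comp (measurable_pi_apply i)).mul (hh.comp (measurable_pi_apply (i + k)))).sub
    ((hg.comp (measurable_pi_apply i)).mul (hkm.comp (measurable_pi_apply i)))

/-- **CONDITIONALLY CENTRED LAG PRODUCTS ARE ORTHOGONAL AT DISTANCE `≥ k`, FROM ANY START**: for
`i + k ≤ j`, `E_{μ₀}[d_i d_j] = 0` with `d_i = g(X_i) h(X_{i+k}) − g(X_i)(kop κ)^k h(X_i)`
(the Markov property at time `j` with the past weight `d_i`). -/
theorem chain_lagProduct_centred_orthogonal (μ₀ : Measure Ω) [IsProbabilityMeasure μ₀]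
    {g h : Ω → ℝ} (hg : Measurable g) {Cg : ℝ} (hCg : ∀ x, |g x| ≤ Cg) (hh : Measurable h) {Ch : ℝ}
    (hCh : ∀ x, |h x| ≤ Ch) {i j k : ℕ} (hij : i + k ≤ j) :
    ∫ x, (g (x i) * h (x (i + k)) - g (x i) * (kop κ)^[k] h (x i))
        * (g (x j) * h (x (j + k)) - g (x j) * (kop κ)^[k] h (x j))
        ∂(Kernel.trajMeasure (X := fun _ : ℕ => Ω) (μ₀)
          (fun n : ℕ => κ.comap (fun h' : (i : ↥(Finset.Iic n)) → Ω => h' ⟨n, Finset.mem_Iic.2 le_rfl⟩)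
            (measurable_pi_apply _))) = 0 := by
  have hCg0 : 0 ≤ Cg := (abs_nonneg _).trans (hCg (Classical.choice (nonempty_of_isProbabilityMeasure μ₀)))
  -- the future functional `Ψ(y) = g(y 0) h(y k)` and its conditional mean `g(z) (kop^k h)(z)`
  have hΨ : Measurable fun y : ℕ → Ω => g (y 0) * h (y k) :=
    (hg.comp (measurable_pi_apply 0)).mul (hh.comp (measurable_pi_apply k))
  have hΨb : ∀ y : ℕ → Ω, |g (y 0) * h (y k)| ≤ Cg * Ch := fun y => by
    rw [abs_mul]; exact mul_le_mul (hCg _) (hCh _) (abs_nonneg _) hCg0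
  have hmean : ∀ z, ∫ y, g (y 0) * h (y k) ∂(Kernel.trajMeasure (X := fun _ : ℕ => Ω) (Measure.dirac z)
        (fun n : ℕ => κ.comap (fun h' : (i : ↥(Finset.Iic n)) → Ω => h' ⟨n, Finset.mem_Iic.2 le_rfl⟩)
          (measurable_pi_apply _))) = g z * (kop κ)^[k] h z := fun z =>
    chain_dirac_integral_mul_eval_eq κ z hg hCg hh hCh k
  -- the past weight `d_i` depends on the coordinates `≤ j`
  have hG := measurable_lagProduct_centred (κ := κ) hg hh hCh i k
  have hGd : DependsOn (fun x : ℕ → Ω => g (x i) * h (x (i + k)) - g (x i) * (kop κ)^[k] h (x i))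
      (Set.Iic j) := by
    intro x y hxy
    have h1 : x i = y i := hxy i (Set.mem_Iic.2 (by omega))
    have h2 : x (i + k) = y (i + k) := hxy (i + k) (Set.mem_Iic.2 hij)
    show g (x i) * h (x (i + k)) - g (x i) * (kop κ)^[k] h (x i)
      = g (y i) * h (y (i + k)) - g (y i) * (kop κ)^[k] h (y i)
    rw [h1, h2]
  have key := chain_shift_centred_orthogonal (κ := κ) μ₀ j hG hGd
    (fun x => abs_lagProduct_centred_le (κ := κ) hCg hh hCh i k x) hΨ hΨb
  simp only [hmean, add_zero] at key
  exact key

/-- **`E_{μ₀}(Σ_{i<N} d_i)² ≤ (2k+1) N (2C_gC_h)²`** for the conditionally centred lag products `d_i`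
(orthogonality off the band `|i−j| ≤ k`, the uniform bound on it). -/
theorem chain_lagProduct_centred_sum_sq_integral_le (μ₀ : Measure Ω) [IsProbabilityMeasure μ₀]
    {g h : Ω → ℝ} (hg : Measurable g) {Cg : ℝ} (hCg : ∀ x, |g x| ≤ Cg) (hh : Measurable h) {Ch : ℝ}
    (hCh : ∀ x, |h x| ≤ Ch) (k N : ℕ) :
    ∫ x, (∑ i ∈ Finset.range N, (g (x i) * h (x (i + k)) - g (x i) * (kop κ)^[k] h (x i))) ^ 2
        ∂(Kernel.trajMeasure (X := fun _ : ℕ => Ω) (μ₀)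
          (fun n : ℕ => κ.comap (fun h' : (i : ↥(Finset.Iic n)) → Ω => h' ⟨n, Finset.mem_Iic.2 le_rfl⟩)
            (measurable_pi_apply _)))
      ≤ (2 * k + 1) * N * (2 * (Cg * Ch)) ^ 2 := by
  set P := (Kernel.trajMeasure (X := fun _ : ℕ => Ω) (μ₀)
        (fun n : ℕ => κ.comap (fun h' : (i : ↥(Finset.Iic n)) → Ω => h' ⟨n, Finset.mem_Iic.2 le_rfl⟩)
          (measurable_pi_apply _))) with hP
  set d : ℕ → (ℕ → Ω) → ℝ := fun i x => g (x i) * h (x (i + k)) - g (x i) * (kop κ)^[k] h (x i) with hd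
  have hdm : ∀ i, Measurable (d i) := fun i => measurable_lagProduct_centred (κ := κ) hg hh hCh i k
  have hdb : ∀ i x, |d i x| ≤ 2 * (Cg * Ch) := fun i x => abs_lagProduct_centred_le (κ := κ) hCg hh hCh i k x
  have hB0 : 0 ≤ 2 * (Cg * Ch) := (abs_nonneg _).trans (hdb 0 (fun _ => Classical.choice
    (nonempty_of_isProbabilityMeasure μ₀)))
  have hint : ∀ i j, Integrable (fun x => d i x * d j x) P := fun i j =>
    integrable_of_bounded P ((hdm i).mul (hdm j)) (C := 2 * (Cg * Ch) * (2 * (Cg * Ch))) fun x => by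
      rw [abs_mul]; exact mul_le_mul (hdb i x) (hdb j x) (abs_nonneg _) hB0
  -- expand the square and integrate termwise
  have hexp : ∫ x, (∑ i ∈ Finset.range N, d i x) ^ 2 ∂P
      = ∑ i ∈ Finset.range N, ∑ j ∈ Finset.range N, ∫ x, d i x * d j x ∂P := by
    have hsq : ∀ x, (∑ i ∈ Finset.range N, d i x) ^ 2
        = ∑ i ∈ Finset.range N, ∑ j ∈ Finset.range N, d i x * d j x := fun x => by
      rw [sq, Finset.sum_mul_sum]
    simp_rw [hsq]
    rw [integral_finsetSum _ (fun i _ => integrable_finsetSum _ (fun j _ => hint i j))]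
    exact Finset.sum_congr rfl fun i _ => integral_finsetSum _ (fun j _ => hint i j)
  show ∫ x, (∑ i ∈ Finset.range N, d i x) ^ 2 ∂P ≤ _
  rw [hexp]
  have hc : ∀ i j, |∫ x, d i x * d j x ∂P| ≤ (2 * (Cg * Ch)) ^ 2 := fun i j => by
    calc |∫ x, d i x * d j x ∂P| = ‖∫ x, d i x * d j x ∂P‖ := (Real.norm_eq_abs _).symm
      _ ≤ (2 * (Cg * Ch) * (2 * (Cg * Ch))) * P.real Set.univ :=
          norm_integral_le_of_norm_le_const (Eventually.of_forall fun x => by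
            rw [Real.norm_eq_abs, abs_mul]; exact mul_le_mul (hdb i x) (hdb j x) (abs_nonneg _) hB0)
      _ = (2 * (Cg * Ch)) ^ 2 := by rw [probReal_univ, mul_one, sq]
  have hz : ∀ i j, i + k < j ∨ j + k < i → ∫ x, d i x * d j x ∂P = 0 := by
    rintro i j (h1 | h2)
    · exact chain_lagProduct_centred_orthogonal (κ := κ) μ₀ hg hCg hh hCh h1.le
    · have hcomm : (fun x => d i x * d j x) = fun x => d j x * d i x := funext fun x => mul_comm _ _
      rw [hcomm]
      exact chain_lagProduct_centred_orthogonal (κ := κ) μ₀ hg hCg hh hCh h2.le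
  exact (le_abs_self _).trans (sum_sum_band_le (sq_nonneg _) hc hz)

variable {π : Measure Ω} [IsProbabilityMeasure π] {A ρ : ℝ}

/-- **THE `L¹` LAW OF LARGE NUMBERS FOR LAG PRODUCTS, FROM ANY START.**  Envelope `(A, ρ)` with
`0 ≤ A`, `0 ≤ ρ < 1`; `|g| ≤ C_g`, `|h| ≤ C_h` measurable; every initial law `μ₀`, every lag `k`,
every `N ≥ 1`:
`E_{μ₀} |(1/N) Σ_{i<N} g(X_i) h(X_{i+k}) − ∫ g·(kop κ)^k h dπ| ≤ (2C_gC_h √(2k+1) + √10·4C_gC_hA/(1−ρ))/√N`. -/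
theorem chain_lagProductAverage_abs_sub_le_of_envelope
    (henv : ∀ (g : Ω → ℝ), Measurable g → ∀ (Cg : ℝ), (∀ x, |g x| ≤ Cg) →
      ∀ (t : ℕ) (x : Ω), |(kop κ)^[t] g x - ∫ y, g y ∂π| ≤ 2 * Cg * (A * ρ ^ t))
    (hA : 0 ≤ A) (hρ0 : 0 ≤ ρ) (hρ1 : ρ < 1)
    {g h : Ω → ℝ} (hg : Measurable g) {Cg : ℝ} (hCg : ∀ x, |g x| ≤ Cg) (hh : Measurable h) {Ch : ℝ}
    (hCh : ∀ x, |h x| ≤ Ch) (μ₀ : Measure Ω) [IsProbabilityMeasure μ₀] (k : ℕ) {N : ℕ} (hN : N ≠ 0) :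
    ∫ x, |(∑ i ∈ Finset.range N, g (x i) * h (x (i + k))) / N - ∫ y, g y * (kop κ)^[k] h y ∂π|
        ∂(Kernel.trajMeasure (X := fun _ : ℕ => Ω) (μ₀)
          (fun n : ℕ => κ.comap (fun h' : (i : ↥(Finset.Iic n)) → Ω => h' ⟨n, Finset.mem_Iic.2 le_rfl⟩)
            (measurable_pi_apply _)))
      ≤ (2 * (Cg * Ch) * Real.sqrt (2 * k + 1) + Real.sqrt 10 * (4 * (Cg * Ch) * A / (1 - ρ)))
          / Real.sqrt N := by
  set P := (Kernel.trajMeasure (X := fun _ : ℕ => Ω) (μ₀)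
        (fun n : ℕ => κ.comap (fun h' : (i : ↥(Finset.Iic n)) → Ω => h' ⟨n, Finset.mem_Iic.2 le_rfl⟩)
          (measurable_pi_apply _))) with hP
  have hCg0 : 0 ≤ Cg := (abs_nonneg _).trans (hCg (Classical.choice (nonempty_of_isProbabilityMeasure μ₀)))
  have hCh0 : 0 ≤ Ch := (abs_nonneg _).trans (hCh (Classical.choice (nonempty_of_isProbabilityMeasure μ₀)))
  have h1ρ : 0 < 1 - ρ := sub_pos.2 hρ1
  have hNpos : (0 : ℝ) < N := by exact_mod_cast Nat.pos_of_ne_zero hN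
  have hsN : 0 < Real.sqrt N := Real.sqrt_pos.2 hNpos
  -- the conditional mean `φ = g · (kop κ)^k h`
  obtain ⟨hkm, hkb⟩ := iterate_kop_bounded_measurable κ hh hCh k
  set φ : Ω → ℝ := fun y => g y * (kop κ)^[k] h y with hφ
  have hφm : Measurable φ := hg.mul hkm
  have hφb : ∀ y, |φ y| ≤ Cg * Ch := fun y => by
    rw [hφ, abs_mul]; exact mul_le_mul (hCg _) (hkb _) (abs_nonneg _) hCg0
  set c : ℝ := ∫ y, φ y ∂π with hc
  set d : ℕ → (ℕ → Ω) → ℝ := fun i x => g (x i) * h (x (i + k)) - g (x i) * (kop κ)^[k] h (x i) with hd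
  have hdm : ∀ i, Measurable (d i) := fun i => measurable_lagProduct_centred (κ := κ) hg hh hCh i k
  have hdb : ∀ i x, |d i x| ≤ 2 * (Cg * Ch) := fun i x => abs_lagProduct_centred_le (κ := κ) hCg hh hCh i k x
  -- the decomposition `Σ g h − N c = Σ d + Σ (φ − c)`
  have hdec : ∀ x : ℕ → Ω, (∑ i ∈ Finset.range N, g (x i) * h (x (i + k))) / N - c
      = ((∑ i ∈ Finset.range N, d i x) + ∑ t ∈ Finset.range N, (φ (x (0 + t)) - c)) / N := by
    intro x
    have hsum : (∑ i ∈ Finset.range N, d i x) + ∑ t ∈ Finset.range N, (φ (x (0 + t)) - c)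
        = (∑ i ∈ Finset.range N, g (x i) * h (x (i + k))) - N * c := by
      rw [← Finset.sum_add_distrib]
      have : ∀ i ∈ Finset.range N, d i x + (φ (x (0 + i)) - c) = g (x i) * h (x (i + k)) - c := by
        intro i _; rw [zero_add, hd, hφ]; ring
      rw [Finset.sum_congr rfl this, Finset.sum_sub_distrib, Finset.sum_const, Finset.card_range,
        nsmul_eq_mul]
    rw [hsum]
    field_simp
  -- the two `L¹` pieces
  have hS1m : Measurable fun x : ℕ → Ω => ∑ i ∈ Finset.range N, d i x :=
    Finset.measurable_sum _ fun i _ => hdm i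
  have hS1b : ∀ x : ℕ → Ω, |∑ i ∈ Finset.range N, d i x| ≤ N * (2 * (Cg * Ch)) := fun x =>
    (Finset.abs_sum_le_sum_abs _ _).trans (by
      calc ∑ i ∈ Finset.range N, |d i x| ≤ ∑ _i ∈ Finset.range N, 2 * (Cg * Ch) :=
            Finset.sum_le_sum fun i _ => hdb i x
        _ = N * (2 * (Cg * Ch)) := by rw [Finset.sum_const, Finset.card_range, nsmul_eq_mul])
  have hS2m : Measurable fun x : ℕ → Ω => ∑ t ∈ Finset.range N, (φ (x (0 + t)) - c) :=
    Finset.measurable_sum _ fun t _ => (hφm.comp (measurable_pi_apply _)).sub_const _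
  have hcb : |c| ≤ Cg * Ch := by
    calc |c| = ‖∫ y, φ y ∂π‖ := (Real.norm_eq_abs _).symm
      _ ≤ (Cg * Ch) * π.real Set.univ := norm_integral_le_of_norm_le_const
          (Eventually.of_forall fun y => by rw [Real.norm_eq_abs]; exact hφb y)
      _ = Cg * Ch := by rw [probReal_univ, mul_one]
  have hS2b : ∀ x : ℕ → Ω, |∑ t ∈ Finset.range N, (φ (x (0 + t)) - c)| ≤ N * (2 * (Cg * Ch)) := fun x =>
    (Finset.abs_sum_le_sum_abs _ _).trans (by
      calc ∑ t ∈ Finset.range N, |φ (x (0 + t)) - c| ≤ ∑ _t ∈ Finset.range N, 2 * (Cg * Ch) :=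
            Finset.sum_le_sum fun t _ => (abs_sub _ _).trans (by linarith [hφb (x (0 + t)), hcb])
        _ = N * (2 * (Cg * Ch)) := by rw [Finset.sum_const, Finset.card_range, nsmul_eq_mul])
  have hE1 : ∫ x, |∑ i ∈ Finset.range N, d i x| ∂P ≤ 2 * (Cg * Ch) * Real.sqrt (2 * k + 1) * Real.sqrt N := by
    refine (integral_abs_le_sqrt_integral_sq P hS1m hS1b).trans ?_
    have h2 := chain_lagProduct_centred_sum_sq_integral_le (κ := κ) μ₀ hg hCg hh hCh k N
    rw [← hP] at h2
    calc Real.sqrt (∫ x, (∑ i ∈ Finset.range N, d i x) ^ 2 ∂P)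
        ≤ Real.sqrt ((2 * k + 1) * N * (2 * (Cg * Ch)) ^ 2) := Real.sqrt_le_sqrt h2
      _ = 2 * (Cg * Ch) * Real.sqrt (2 * k + 1) * Real.sqrt N := by
          rw [Real.sqrt_mul (by positivity), Real.sqrt_mul (by positivity),
            Real.sqrt_sq (by positivity)]
          ring
  have hE2 : ∫ x, |∑ t ∈ Finset.range N, (φ (x (0 + t)) - c)| ∂P
      ≤ Real.sqrt 10 * (4 * (Cg * Ch) * A / (1 - ρ)) * Real.sqrt N := by
    refine (integral_abs_le_sqrt_integral_sq P hS2m hS2b).trans ?_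
    have h2 := chain_blockSum_sq_le_of_envelope (κ := κ) henv hρ0 hρ1 hφm hφb μ₀ 0 hN
    rw [← hP] at h2
    calc Real.sqrt (∫ x, (∑ t ∈ Finset.range N, (φ (x (0 + t)) - c)) ^ 2 ∂P)
        ≤ Real.sqrt (10 * (4 * (Cg * Ch) * A / (1 - ρ)) ^ 2 * N) := Real.sqrt_le_sqrt h2
      _ = Real.sqrt 10 * (4 * (Cg * Ch) * A / (1 - ρ)) * Real.sqrt N := by
          rw [Real.sqrt_mul (by positivity), Real.sqrt_mul (by positivity),
            Real.sqrt_sq (by positivity)]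
  -- assemble
  have hI1 : Integrable (fun x : ℕ → Ω => |∑ i ∈ Finset.range N, d i x| / N) P :=
    (integrable_of_bounded P (continuous_abs.measurable.comp hS1m) (C := N * (2 * (Cg * Ch)))
      (fun x => by rw [Function.comp_apply, abs_abs]; exact hS1b x)).div_const _
  have hI2 : Integrable (fun x : ℕ → Ω => |∑ t ∈ Finset.range N, (φ (x (0 + t)) - c)| / N) P :=
    (integrable_of_bounded P (continuous_abs.measurable.comp hS2m) (C := N * (2 * (Cg * Ch)))
      (fun x => by rw [Function.comp_apply, abs_abs]; exact hS2b x)).div_const _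
  calc ∫ x, |(∑ i ∈ Finset.range N, g (x i) * h (x (i + k))) / N - c| ∂P
      = ∫ x, |((∑ i ∈ Finset.range N, d i x) + ∑ t ∈ Finset.range N, (φ (x (0 + t)) - c)) / N| ∂P := by
        exact integral_congr_ae (ae_of_all _ fun x => congrArg abs (hdec x))
    _ ≤ ∫ x, (|∑ i ∈ Finset.range N, d i x| / N + |∑ t ∈ Finset.range N, (φ (x (0 + t)) - c)| / N) ∂P := by
        refine integral_mono_of_nonneg (ae_of_all _ fun x => abs_nonneg _) (hI1.add hI2)
          (ae_of_all _ fun x => ?_)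
        show |((∑ i ∈ Finset.range N, d i x) + ∑ t ∈ Finset.range N, (φ (x (0 + t)) - c)) / N|
          ≤ |∑ i ∈ Finset.range N, d i x| / N + |∑ t ∈ Finset.range N, (φ (x (0 + t)) - c)| / N
        rw [abs_div, abs_of_pos hNpos, ← add_div]
        exact div_le_div_of_nonneg_right (abs_add_le _ _) hNpos.le
    _ = (∫ x, |∑ i ∈ Finset.range N, d i x| ∂P) / N
        + (∫ x, |∑ t ∈ Finset.range N, (φ (x (0 + t)) - c)| ∂P) / N := by
        rw [integral_add hI1 hI2, integral_div, integral_div]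
    _ ≤ (2 * (Cg * Ch) * Real.sqrt (2 * k + 1) * Real.sqrt N) / N
        + (Real.sqrt 10 * (4 * (Cg * Ch) * A / (1 - ρ)) * Real.sqrt N) / N :=
        add_le_add (div_le_div_of_nonneg_right hE1 hNpos.le) (div_le_div_of_nonneg_right hE2 hNpos.le)
    _ = (2 * (Cg * Ch) * Real.sqrt (2 * k + 1) + Real.sqrt 10 * (4 * (Cg * Ch) * A / (1 - ρ)))
          / Real.sqrt N := by
        have e : ∀ a : ℝ, a * Real.sqrt N / N = a / Real.sqrt N := fun a => by
          rw [mul_div_assoc, Real.sqrt_div_self', mul_one_div]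
        rw [e, e, ← add_div]

/-- **THE SAMPLE AUTOCOVARIANCE WITH KNOWN MEAN CONVERGES IN `L¹` FROM ANY START**: with
`f̄ = f − πf` (`|f| ≤ C`), for every `μ₀`, `k`, `N ≥ 1`:
`E_{μ₀} |(1/N) Σ_{i<N} f̄(X_i) f̄(X_{i+k}) − autocov κ π f̄ k| ≤ 8C² (√(2k+1) + 2√10·A/(1−ρ))/√N`. -/
theorem chain_sampleAutocov_abs_sub_le_of_envelope
    (henv : ∀ (g : Ω → ℝ), Measurable g → ∀ (Cg : ℝ), (∀ x, |g x| ≤ Cg) →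
      ∀ (t : ℕ) (x : Ω), |(kop κ)^[t] g x - ∫ y, g y ∂π| ≤ 2 * Cg * (A * ρ ^ t))
    (hA : 0 ≤ A) (hρ0 : 0 ≤ ρ) (hρ1 : ρ < 1)
    {f : Ω → ℝ} (hf : Measurable f) {C : ℝ} (hC : ∀ x, |f x| ≤ C)
    (μ₀ : Measure Ω) [IsProbabilityMeasure μ₀] (k : ℕ) {N : ℕ} (hN : N ≠ 0) :
    ∫ x, |(∑ i ∈ Finset.range N, (f (x i) - ∫ z, f z ∂π) * (f (x (i + k)) - ∫ z, f z ∂π)) / N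
          - autocov κ π (fun y => f y - ∫ z, f z ∂π) k|
        ∂(Kernel.trajMeasure (X := fun _ : ℕ => Ω) (μ₀)
          (fun n : ℕ => κ.comap (fun h' : (i : ↥(Finset.Iic n)) → Ω => h' ⟨n, Finset.mem_Iic.2 le_rfl⟩)
            (measurable_pi_apply _)))
      ≤ 8 * C ^ 2 * (Real.sqrt (2 * k + 1) + 2 * Real.sqrt 10 * A / (1 - ρ)) / Real.sqrt N := by
  obtain ⟨hfb, hCfb, -⟩ := centred_observable_bounds π hf hC
  have h1 := chain_lagProductAverage_abs_sub_le_of_envelope henv hA hρ0 hρ1 hfb hCfb hfb hCfb μ₀ k hN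
  refine h1.trans (le_of_eq ?_)
  ring

end Chain

end Summit.Ventures.LatticeQCDFlow.Scoring

end
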